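import Summits.Langlands.Langlands.Theses.NonParallelVoid

/-!
# BIRTH SKELETON (BC3) — crux stmt-Langlands-17003 `NonParallelVoid.ResidueParallel`
(route `route-Langlands-NonParallelVoid`, rank 6), line `birth` = the route's own description of THE RESIDUE,
typed as a four-piece REGIME PARTITION of the crux hypothesis "not in the good regime"
`¬ (11 ≤ p ∧ p split ∧ crystalline ∧ ρ̄|Γ_(F(ζ_p)) abs. irreducible)`.

Registered by `planner-skel-stmt-Langlands-17003-0` (skeleton registrar, 2026-08-17).  Four NAMED stubs, the
kernel-checked composition `ResidueParallel_of : ResidueParallel` (BY NAME; the stubs are used by name in its body —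
the shape `#h21_check_skeleton` registers) and, as an `example`, the same composition in hypothetical form
`<stub₁-sig> → <stub₂-sig> → <stub₃-sig> → <stub₄-sig> → ResidueParallel` (sorry-free pure logic).

## The cut

The crux: `F` imaginary quadratic, `p` prime, `ρ : Γ_F → GL₂(ℚ̄_p)` irreducible, a.e. unramified, de Rham at
every `v ∣ p` with two distinct `τ`-labelled Hodge–Tate weights for every label, NOT nearly ordinary
(`¬ ∀ v ∣ p, invariant line`) and NOT in the good regime ⇒ the gaps are parallel.  De Morgan on the good-regime
conjunction, ordered so that the pieces are DISJOINT and each is the home of exactly one mechanism named in the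
route header:

* `stub_residuallyReducibleCorner` — `ρ̄|Γ_(F(ζ_p))` absolutely REDUCIBLE (any `p`, any splitting, any local
  type), `ρ` locally irreducible at some `v ∣ p`.  THE DARK CORNER of the route header ("residually reducible,
  locally irreducible (supersingular) non-parallel ρ have no lever at all": no residually reducible potentially
  diagonalisable lifting theorem, no Eisenstein/Hida torsion engine off the nearly ordinary locus).  Contains the
  residually dihedral-over-`F(ζ_p)` representations as well.  [cite: CalegariMazur2008, Conj. 1.3]
  [cite: arXiv:2001.04956, §1.5]  OPEN-PROBLEM sized.
* `stub_smallPrimes` — `p ≤ 7` (typed `p < 11`), `ρ̄|Γ_(F(ζ_p))` absolutely irreducible.  Every cited engine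
  needs `l ≥ 2(n+1) = 10` for `n = 4` (BarnetlambEtAl2014 Thm C applied to `Ind(ρ⊗φ)` / `ρ ⊗ ρ^c`) or `p > 7`
  (Calegari2010 Thm 1.4); `p = 2, 3` escape everything.  The statement is the same parallelism claim; the
  content is an engine with a smaller bound (e.g. adequacy instead of bigness for `p = 5, 7`, Thorne 2012) or a
  `p`-switch (compatible family through a larger prime is NOT available: `ρ` is a single `p`-adic representation
  of unknown motivic origin).  [cite: BarnetlambEtAl2014, Thm C] [cite: Calegari2010, Thm 1.4]  L/open.
* `stub_nonsplitPrime` — `p ≥ 11` INERT OR RAMIFIED in `F` (typed: no two distinct primes of `𝓞_F` above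
  `p`), `ρ̄|Γ_(F(ζ_p))` absolutely irreducible, any local type at the unique `v ∣ p`.  Route header: "for p inert
  the twisted-induction lever applies verbatim given potential diagonalisability of 2-dimensional crystalline
  representations of `Γ_(ℚ_(p²))`" (route WachComponentCensus territory; Gee–Liu–Savitt range / Kisin
  components), plus the potentially crystalline case over the quadratic local field.
  [cite: BarnetlambEtAl2014, Thm C] [cite: Kisin2009]  L-sized.
* `stub_potentiallyCrystalline` — `p ≥ 11` SPLIT, `ρ` NOT crystalline at some `v ∣ p` (only potentially
  crystalline / potentially semistable there), `ρ̄|Γ_(F(ζ_p))` absolutely irreducible.  Needs potential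
  diagonalisability of 2-dimensional potentially crystalline representations of `Γ_(ℚ_p)` with distinct
  weights (then the twisted-induction / tensor-square levers of cruxes 3–4 run verbatim), and a separate word on
  the potentially semistable `N ≠ 0` place (where `ρ|Γ_(F_w)` is reducible but `ρ|Γ_(F_v)` is not).
  [cite: BarnetlambEtAl2014, §1.4, Thm C] [cite: Kisin2009]  L-sized.

The composition is the exhaustive case split `by_cases` on (residual irreducibility, `11 ≤ p`, split,
crystalline); the all-yes branch contradicts the crux hypothesis `¬ (good regime)`.  No stub is the crux or the
summit in costume: each is the crux RESTRICTED to a proper sub-regime (strictly weaker), and the BC3 probes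
`stub → ResidueParallel` / `stub → Langlands` by `first | exact? | simpa | aesop` fail (bc/ probe files, NOTES.md
of the registrar).

Disproof used: none — no `Disproof.lean` exists on this crux at registration time (`ledger crux ls
stmt-Langlands-17003`: no workfiles).  Dead lines: none recorded.  Barriers honoured as in the route header:
`Literature.Barriers.Langlands.ResiduallyReducibleBarrier` is ISOLATED in `stub_residuallyReducibleCorner`
(the route's honest "it does not evade it"); `Literature.Barriers.Langlands.PatchingLocalComponentBarrier`
(potential diagonalisability as a hypothesis not met for free off split crystalline `p`) is exactly the content
of `stub_nonsplitPrime` / `stub_potentiallyCrystalline`.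

Leans on (by name): `Summit.Langlands.Langlands.Theses.NonParallelVoid.ResidueParallel` (the crux),
`Literature.NumberTheory.GaloisRepresentations.FramedGaloisRep` (+ `.toGaloisRep.IsIrreducible`,
`.IsUnramifiedAt`, `.toLocal`, `.labelledHodgeTateWeightsAt`, `.restrictField`, `.IsResiduallyAbsIrreducible`),
`Literature.NumberTheory.GaloisRepresentations.FramedRep.HasInvariantCompleteFlag`,
`Literature.NumberTheory.PAdicHodge.fontainePstAdicCompletion` (+ `.IsDeRhamFramed`, `.IsCrystallineFramed`,
`.algebra`, `.𝔅`), `CyclotomicField`, `PadicAlgCl` — all through the route file's imports.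
-/

noncomputable section

open scoped BigOperators Topology Manifold Classical MeasureTheory ProbabilityTheory Matrix InnerProductSpace ComplexConjugate ContinuousMap
open Filter Set Function TopologicalSpace MeasureTheory

-- `Summit.Langlands.Langlands.…`: summit = sub-problem name (D-0017 nested layout), not a typo.
set_option linter.dupNamespace false

namespace Summit.Langlands.Langlands.Cruxes.ResidueParallel.Birth

/-- **STUB 1 — `residuallyReducibleCorner` (THE DARK CORNER).**  `F` imaginary quadratic, `p` any prime,
`ρ : Γ_F → GL₂(ℚ̄_p)` irreducible, a.e. unramified, de Rham above `p` with two distinct labelled Hodge–Tate weights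
for every label, NOT nearly ordinary (no invariant line at some `v ∣ p`), and `ρ̄|Γ_(F(ζ_p))` absolutely
REDUCIBLE ⇒ all labels have the same gap.  No lever is known (no residually reducible potentially diagonalisable
automorphy lifting; Skinner–Wiles / Eisenstein-torsion engines live on the nearly ordinary locus, which is crux
`LocallyReducibleParallel`).  [cite: CalegariMazur2008, Conj. 1.3] [cite: arXiv:2001.04956, §1.5] — OPEN. -/
theorem stub_residuallyReducibleCorner :
    ∀ (F : Type) [Field F] [NumberField F] [Algebra.IsQuadraticExtension ℚ F], NumberField.IsTotallyComplex F → ∀ (p : ℕ) [Fact p.Prime] (ρ : Literature.NumberTheory.GaloisRepresentations.FramedGaloisRep F (PadicAlgCl p) 2), ρ.toGaloisRep.IsIrreducible → (∀ᶠ v : IsDedekindDomain.HeightOneSpectrum (NumberField.RingOfIntegers F) in Filter.cofinite, ρ.IsUnramifiedAt v) → (∀ (v : IsDedekindDomain.HeightOneSpectrum (NumberField.RingOfIntegers F)) (hv : ((p : ℕ) : NumberField.RingOfIntegers F) ∈ v.asIdeal), (Literature.NumberTheory.PAdicHodge.fontainePstAdicCompletion v p hv).IsDeRhamFramed (ρ.toLocal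 v) ∧ (letI := (Literature.NumberTheory.PAdicHodge.fontainePstAdicCompletion v p hv).algebra; ∀ τ : v.adicCompletion F →ₐ[ℚ_[p]] PadicAlgCl p, ∃ a b : ℤ, a < b ∧ ρ.labelledHodgeTateWeightsAt v (Literature.NumberTheory.PAdicHodge.fontainePstAdicCompletion v p hv).algebra (Literature.NumberTheory.PAdicHodge.fontainePstAdicCompletion v p hv).𝔅 τ.toRingHom = {a, b})) → ¬ (∀ v : IsDedekindDomain.HeightOneSpectrum (NumberField.RingOfIntegers F), ((p : ℕ) : NumberField.RingOfIntegers F) ∈ v.asIdeal → Literature.NumberTheory.GaloisRepresentations.FramedRep.HasInvariantCompleteFlag (ρ.toLocal v)) → ¬ Literature.NumberTheory.GaloisRepresentations.FramedGaloisRep.IsResiduallyAbsIrreducible (ρ.restrictField (CyclotomicField p F)) → ∃ g : ℤ, ∀ (v : IsDedekindDomain.HeightOneSpectrum (NumberField.RingOfIntegers F)) (hv : ((p : ℕ) : NumberField.RingOfIntegers F) ∈ v.asIdeal), letI := (Literature.NumberTheory.PAdicHodge.fontainePstAdicCompletion v p hv).algebra; ∀ τ : v.adicCompletion F →ₐ[ℚ_[p]]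 PadicAlgCl p, ∃ a : ℤ, ρ.labelledHodgeTateWeightsAt v (Literature.NumberTheory.PAdicHodge.fontainePstAdicCompletion v p hv).algebra (Literature.NumberTheory.PAdicHodge.fontainePstAdicCompletion v p hv).𝔅 τ.toRingHom = {a, a + g} := by
  sorry

/-- **STUB 2 — `smallPrimes`.**  Same `F, ρ` (not nearly ordinary), `p < 11` (i.e. `p ≤ 7`), and `ρ̄|Γ_(F(ζ_p))`
absolutely irreducible ⇒ all labels have the same gap.  Below the bound `l ≥ 2(n+1) = 10` of
[cite: BarnetlambEtAl2014, Thm C] for the rank-4 induced / tensored representation and below `p > 7` of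
[cite: Calegari2010, Thm 1.4]; `p = 2, 3` escape every cited theorem. — OPEN (L for `p = 5, 7` with an
adequacy-based engine, open-problem at `p = 2, 3`). -/
theorem stub_smallPrimes :
    ∀ (F : Type) [Field F] [NumberField F] [Algebra.IsQuadraticExtension ℚ F], NumberField.IsTotallyComplex F → ∀ (p : ℕ) [Fact p.Prime] (ρ : Literature.NumberTheory.GaloisRepresentations.FramedGaloisRep F (PadicAlgCl p) 2), ρ.toGaloisRep.IsIrreducible → (∀ᶠ v : IsDedekindDomain.HeightOneSpectrum (NumberField.RingOfIntegers F) in Filter.cofinite, ρ.IsUnramifiedAt v) → (∀ (v : IsDedekindDomain.HeightOneSpectrum (NumberField.RingOfIntegers F)) (hv : ((p : ℕ) : NumberField.RingOfIntegers F) ∈ v.asIdeal), (Literature.NumberTheory.PAdicHodge.fontainePstAdicCompletion v p hv).IsDeRhamFramed (ρ.toLocal v) ∧ (letI := (Literature.NumberTheory.PAdicHodge.fontainePstAdicCompletion v p hv).algebra; ∀ τ : v.adicCompletion F →ₐ[ℚ_[p]] PadicAlgCl p, ∃ a b : ℤ, a < b ∧ ρ.labelledHodgeTateWeightsAt v (Literature.NumberTheory.PAdicHodge.fontainePstAdicCompletion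 v p hv).algebra (Literature.NumberTheory.PAdicHodge.fontainePstAdicCompletion v p hv).𝔅 τ.toRingHom = {a, b})) → ¬ (∀ v : IsDedekindDomain.HeightOneSpectrum (NumberField.RingOfIntegers F), ((p : ℕ) : NumberField.RingOfIntegers F) ∈ v.asIdeal → Literature.NumberTheory.GaloisRepresentations.FramedRep.HasInvariantCompleteFlag (ρ.toLocal v)) → p < 11 → Literature.NumberTheory.GaloisRepresentations.FramedGaloisRep.IsResiduallyAbsIrreducible (ρ.restrictField (CyclotomicField p F)) → ∃ g : ℤ, ∀ (v : IsDedekindDomain.HeightOneSpectrum (NumberField.RingOfIntegers F)) (hv : ((p : ℕ) : NumberField.RingOfIntegers F) ∈ v.asIdeal), letI := (Literature.NumberTheory.PAdicHodge.fontainePstAdicCompletion v p hv).algebra; ∀ τ : v.adicCompletion F →ₐ[ℚ_[p]] PadicAlgCl p, ∃ a : ℤ, ρ.labelledHodgeTateWeightsAt v (Literature.NumberTheory.PAdicHodge.fontainePstAdicCompletion v p hv).algebra (Literature.NumberTheory.PAdicHodge.fontainePstAdicCompletion v p hv).𝔅 τ.toRingHom = {a, a + g} := by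
  sorry

/-- **STUB 3 — `nonsplitPrime`.**  Same `F, ρ` (not nearly ordinary), `11 ≤ p`, `p` INERT OR RAMIFIED in `F` (no two
distinct primes of `𝓞_F` above `p`), `ρ̄|Γ_(F(ζ_p))` absolutely irreducible ⇒ all labels have the same gap.  The
twisted-induction lever of crux `TwistedInductionParallel` / the tensor square of `TensorSquareParallel` apply
verbatim GIVEN potential diagonalisability of the 2-dimensional (potentially) crystalline representation
`ρ|Γ_(F_v)` of the quadratic local field `F_v` with distinct labelled weights (route WachComponentCensus).
[cite: BarnetlambEtAl2014, Thm C] [cite: Kisin2009] — L-sized. -/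
theorem stub_nonsplitPrime :
    ∀ (F : Type) [Field F] [NumberField F] [Algebra.IsQuadraticExtension ℚ F], NumberField.IsTotallyComplex F → ∀ (p : ℕ) [Fact p.Prime] (ρ : Literature.NumberTheory.GaloisRepresentations.FramedGaloisRep F (PadicAlgCl p) 2), ρ.toGaloisRep.IsIrreducible → (∀ᶠ v : IsDedekindDomain.HeightOneSpectrum (NumberField.RingOfIntegers F) in Filter.cofinite, ρ.IsUnramifiedAt v) → (∀ (v : IsDedekindDomain.HeightOneSpectrum (NumberField.RingOfIntegers F)) (hv : ((p : ℕ) : NumberField.RingOfIntegers F) ∈ v.asIdeal), (Literature.NumberTheory.PAdicHodge.fontainePstAdicCompletion v p hv).IsDeRhamFramed (ρ.toLocal v) ∧ (letI := (Literature.NumberTheory.PAdicHodge.fontainePstAdicCompletion v p hv).algebra; ∀ τ : v.adicCompletion F →ₐ[ℚ_[p]] PadicAlgCl p, ∃ a b : ℤ, a < b ∧ ρ.labelledHodgeTateWeightsAt v (Literature.NumberTheory.PAdicHodge.fontainePstAdicCompletion v p hv).algebra (Literature.NumberTheory.PAdicHodge.fontainePstAdicCompletion v p hv).𝔅 τ.toRingHom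 = {a, b})) → ¬ (∀ v : IsDedekindDomain.HeightOneSpectrum (NumberField.RingOfIntegers F), ((p : ℕ) : NumberField.RingOfIntegers F) ∈ v.asIdeal → Literature.NumberTheory.GaloisRepresentations.FramedRep.HasInvariantCompleteFlag (ρ.toLocal v)) → 11 ≤ p → ¬ (∃ v w : IsDedekindDomain.HeightOneSpectrum (NumberField.RingOfIntegers F), v ≠ w ∧ ((p : ℕ) : NumberField.RingOfIntegers F) ∈ v.asIdeal ∧ ((p : ℕ) : NumberField.RingOfIntegers F) ∈ w.asIdeal) → Literature.NumberTheory.GaloisRepresentations.FramedGaloisRep.IsResiduallyAbsIrreducible (ρ.restrictField (CyclotomicField p F)) → ∃ g : ℤ, ∀ (v : IsDedekindDomain.HeightOneSpectrum (NumberField.RingOfIntegers F)) (hv : ((p : ℕ) : NumberField.RingOfIntegers F) ∈ v.asIdeal), letI := (Literature.NumberTheory.PAdicHodge.fontainePstAdicCompletion v p hv).algebra; ∀ τ : v.adicCompletion F →ₐ[ℚ_[p]] PadicAlgCl p, ∃ a : ℤ, ρ.labelledHodgeTateWeightsAt v (Literature.NumberTheory.PAdicHodge.fontainePstAdicCompletion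 v p hv).algebra (Literature.NumberTheory.PAdicHodge.fontainePstAdicCompletion v p hv).𝔅 τ.toRingHom = {a, a + g} := by
  sorry

/-- **STUB 4 — `potentiallyCrystalline`.**  Same `F, ρ` (not nearly ordinary), `11 ≤ p`, `p` SPLIT in `F`, `ρ` NOT
crystalline at some `v ∣ p` (only potentially crystalline / potentially semistable there: the Statement's de Rham
hypothesis), `ρ̄|Γ_(F(ζ_p))` absolutely irreducible ⇒ all labels have the same gap.  Needs potential
diagonalisability of 2-dimensional potentially crystalline representations of `Γ_(ℚ_p)` with distinct weights
(then cruxes 3–4 run verbatim) and a treatment of a potentially semistable `N ≠ 0` place `w` (where `ρ|Γ_(F_w)`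
is reducible while `ρ|Γ_(F_v)` is not).  [cite: BarnetlambEtAl2014, §1.4 and Thm C] [cite: Kisin2009] — L-sized. -/
theorem stub_potentiallyCrystalline :
    ∀ (F : Type) [Field F] [NumberField F] [Algebra.IsQuadraticExtension ℚ F], NumberField.IsTotallyComplex F → ∀ (p : ℕ) [Fact p.Prime] (ρ : Literature.NumberTheory.GaloisRepresentations.FramedGaloisRep F (PadicAlgCl p) 2), ρ.toGaloisRep.IsIrreducible → (∀ᶠ v : IsDedekindDomain.HeightOneSpectrum (NumberField.RingOfIntegers F) in Filter.cofinite, ρ.IsUnramifiedAt v) → (∀ (v : IsDedekindDomain.HeightOneSpectrum (NumberField.RingOfIntegers F)) (hv : ((p : ℕ) : NumberField.RingOfIntegers F) ∈ v.asIdeal), (Literature.NumberTheory.PAdicHodge.fontainePstAdicCompletion v p hv).IsDeRhamFramed (ρ.toLocal v) ∧ (letI := (Literature.NumberTheory.PAdicHodge.fontainePstAdicCompletion v p hv).algebra; ∀ τ : v.adicCompletion F →ₐ[ℚ_[p]] PadicAlgCl p, ∃ a b : ℤ, a < b ∧ ρ.labelledHodgeTateWeightsAt v (Literature.NumberTheory.PAdicHodge.fontainePstAdicCompletion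 v p hv).algebra (Literature.NumberTheory.PAdicHodge.fontainePstAdicCompletion v p hv).𝔅 τ.toRingHom = {a, b})) → ¬ (∀ v : IsDedekindDomain.HeightOneSpectrum (NumberField.RingOfIntegers F), ((p : ℕ) : NumberField.RingOfIntegers F) ∈ v.asIdeal → Literature.NumberTheory.GaloisRepresentations.FramedRep.HasInvariantCompleteFlag (ρ.toLocal v)) → 11 ≤ p → (∃ v w : IsDedekindDomain.HeightOneSpectrum (NumberField.RingOfIntegers F), v ≠ w ∧ ((p : ℕ) : NumberField.RingOfIntegers F) ∈ v.asIdeal ∧ ((p : ℕ) : NumberField.RingOfIntegers F) ∈ w.asIdeal) → ¬ (∀ (v : IsDedekindDomain.HeightOneSpectrum (NumberField.RingOfIntegers F)) (hv : ((p : ℕ) : NumberField.RingOfIntegers F) ∈ v.asIdeal), (Literature.NumberTheory.PAdicHodge.fontainePstAdicCompletion v p hv).IsCrystallineFramed (ρ.toLocal v)) → Literature.NumberTheory.GaloisRepresentations.FramedGaloisRep.IsResiduallyAbsIrreducible (ρ.restrictField (CyclotomicField p F)) → ∃ g : ℤ, ∀ (v : IsDedekindDomain.HeightOneSpectrum (NumberField.RingOfIntegers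 F)) (hv : ((p : ℕ) : NumberField.RingOfIntegers F) ∈ v.asIdeal), letI := (Literature.NumberTheory.PAdicHodge.fontainePstAdicCompletion v p hv).algebra; ∀ τ : v.adicCompletion F →ₐ[ℚ_[p]] PadicAlgCl p, ∃ a : ℤ, ρ.labelledHodgeTateWeightsAt v (Literature.NumberTheory.PAdicHodge.fontainePstAdicCompletion v p hv).algebra (Literature.NumberTheory.PAdicHodge.fontainePstAdicCompletion v p hv).𝔅 τ.toRingHom = {a, a + g} := by
  sorry

/-- **The crux BY NAME from the four stubs** (the registered skeleton theorem: no hypotheses; the four declared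
stubs are used by name in the body).  Exhaustive case split on (residual absolute irreducibility over `F(ζ_p)`,
`11 ≤ p`, `p` split, `ρ` crystalline above `p`); the all-yes branch contradicts the crux hypothesis
`¬ (good regime)`. [folklore] -/
theorem ResidueParallel_of :
    Summit.Langlands.Langlands.Theses.NonParallelVoid.ResidueParallel := by
  intro F _ _ _ hF p _ ρ hirr hunr hHT hLR hG
  by_cases hres : Literature.NumberTheory.GaloisRepresentations.FramedGaloisRep.IsResiduallyAbsIrreducible (ρ.restrictField (CyclotomicField p F))
  · by_cases hp : 11 ≤ p
    · by_cases hsplit : (∃ v w : IsDedekindDomain.HeightOneSpectrum (NumberField.RingOfIntegers F), v ≠ w ∧ ((p : ℕ) : NumberField.RingOfIntegers F) ∈ v.asIdeal ∧ ((p : ℕ) : NumberField.RingOfIntegers F) ∈ w.asIdeal)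
      · by_cases hcrys : (∀ (v : IsDedekindDomain.HeightOneSpectrum (NumberField.RingOfIntegers F)) (hv : ((p : ℕ) : NumberField.RingOfIntegers F) ∈ v.asIdeal), (Literature.NumberTheory.PAdicHodge.fontainePstAdicCompletion v p hv).IsCrystallineFramed (ρ.toLocal v))
        · exact absurd ⟨hp, hsplit, hcrys, hres⟩ hG
        · exact stub_potentiallyCrystalline F hF p ρ hirr hunr hHT hLR hp hsplit hcrys hres
      · exact stub_nonsplitPrime F hF p ρ hirr hunr hHT hLR hp hsplit hres
    · exact stub_smallPrimes F hF p ρ hirr hunr hHT hLR (Nat.lt_of_not_le hp) hres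
  · exact stub_residuallyReducibleCorner F hF p ρ hirr hunr hHT hLR hres

/-- **The same composition as PURE LOGIC, hypothetical form**
`<stub₁-sig> → <stub₂-sig> → <stub₃-sig> → <stub₄-sig> → ResidueParallel` (sorry-free and axiom-clean: this is
the real proof that the four stub statements imply the crux; written as an `example` so that the skeleton audit
sees exactly one theorem concluding the crux). [folklore] -/
example :
    (∀ (F : Type) [Field F] [NumberField F] [Algebra.IsQuadraticExtension ℚ F], NumberField.IsTotallyComplex F → ∀ (p : ℕ) [Fact p.Prime] (ρ : Literature.NumberTheory.GaloisRepresentations.FramedGaloisRep F (PadicAlgCl p) 2), ρ.toGaloisRep.IsIrreducible → (∀ᶠ v : IsDedekindDomain.HeightOneSpectrum (NumberField.RingOfIntegers F) in Filter.cofinite, ρ.IsUnramifiedAt v) → (∀ (v : IsDedekindDomain.HeightOneSpectrum (NumberField.RingOfIntegers F)) (hv : ((p : ℕ) : NumberField.RingOfIntegers F) ∈ v.asIdeal), (Literature.NumberTheory.PAdicHodge.fontainePstAdicCompletion v p hv).IsDeRhamFramed (ρ.toLocal v) ∧ (letI := (Literature.NumberTheory.PAdicHodge.fontainePstAdicCompletion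 v p hv).algebra; ∀ τ : v.adicCompletion F →ₐ[ℚ_[p]] PadicAlgCl p, ∃ a b : ℤ, a < b ∧ ρ.labelledHodgeTateWeightsAt v (Literature.NumberTheory.PAdicHodge.fontainePstAdicCompletion v p hv).algebra (Literature.NumberTheory.PAdicHodge.fontainePstAdicCompletion v p hv).𝔅 τ.toRingHom = {a, b})) → ¬ (∀ v : IsDedekindDomain.HeightOneSpectrum (NumberField.RingOfIntegers F), ((p : ℕ) : NumberField.RingOfIntegers F) ∈ v.asIdeal → Literature.NumberTheory.GaloisRepresentations.FramedRep.HasInvariantCompleteFlag (ρ.toLocal v)) → ¬ Literature.NumberTheory.GaloisRepresentations.FramedGaloisRep.IsResiduallyAbsIrreducible (ρ.restrictField (CyclotomicField p F)) → ∃ g : ℤ, ∀ (v : IsDedekindDomain.HeightOneSpectrum (NumberField.RingOfIntegers F)) (hv : ((p : ℕ) : NumberField.RingOfIntegers F) ∈ v.asIdeal), letI := (Literature.NumberTheory.PAdicHodge.fontainePstAdicCompletion v p hv).algebra; ∀ τ : v.adicCompletion F →ₐ[ℚ_[p]] PadicAlgCl p, ∃ a : ℤ, ρ.labelledHodgeTateWeightsAt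 v (Literature.NumberTheory.PAdicHodge.fontainePstAdicCompletion v p hv).algebra (Literature.NumberTheory.PAdicHodge.fontainePstAdicCompletion v p hv).𝔅 τ.toRingHom = {a, a + g}) →
    (∀ (F : Type) [Field F] [NumberField F] [Algebra.IsQuadraticExtension ℚ F], NumberField.IsTotallyComplex F → ∀ (p : ℕ) [Fact p.Prime] (ρ : Literature.NumberTheory.GaloisRepresentations.FramedGaloisRep F (PadicAlgCl p) 2), ρ.toGaloisRep.IsIrreducible → (∀ᶠ v : IsDedekindDomain.HeightOneSpectrum (NumberField.RingOfIntegers F) in Filter.cofinite, ρ.IsUnramifiedAt v) → (∀ (v : IsDedekindDomain.HeightOneSpectrum (NumberField.RingOfIntegers F)) (hv : ((p : ℕ) : NumberField.RingOfIntegers F) ∈ v.asIdeal), (Literature.NumberTheory.PAdicHodge.fontainePstAdicCompletion v p hv).IsDeRhamFramed (ρ.toLocal v) ∧ (letI := (Literature.NumberTheory.PAdicHodge.fontainePstAdicCompletion v p hv).algebra; ∀ τ : v.adicCompletion F →ₐ[ℚ_[p]] PadicAlgCl p, ∃ a b : ℤ, a < b ∧ ρ.labelledHodgeTateWeightsAt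 v (Literature.NumberTheory.PAdicHodge.fontainePstAdicCompletion v p hv).algebra (Literature.NumberTheory.PAdicHodge.fontainePstAdicCompletion v p hv).𝔅 τ.toRingHom = {a, b})) → ¬ (∀ v : IsDedekindDomain.HeightOneSpectrum (NumberField.RingOfIntegers F), ((p : ℕ) : NumberField.RingOfIntegers F) ∈ v.asIdeal → Literature.NumberTheory.GaloisRepresentations.FramedRep.HasInvariantCompleteFlag (ρ.toLocal v)) → p < 11 → Literature.NumberTheory.GaloisRepresentations.FramedGaloisRep.IsResiduallyAbsIrreducible (ρ.restrictField (CyclotomicField p F)) → ∃ g : ℤ, ∀ (v : IsDedekindDomain.HeightOneSpectrum (NumberField.RingOfIntegers F)) (hv : ((p : ℕ) : NumberField.RingOfIntegers F) ∈ v.asIdeal), letI := (Literature.NumberTheory.PAdicHodge.fontainePstAdicCompletion v p hv).algebra; ∀ τ : v.adicCompletion F →ₐ[ℚ_[p]] PadicAlgCl p, ∃ a : ℤ, ρ.labelledHodgeTateWeightsAt v (Literature.NumberTheory.PAdicHodge.fontainePstAdicCompletion v p hv).algebra (Literature.NumberTheory.PAdicHodge.fontainePstAdicCompletion v p hv).𝔅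 τ.toRingHom = {a, a + g}) →
    (∀ (F : Type) [Field F] [NumberField F] [Algebra.IsQuadraticExtension ℚ F], NumberField.IsTotallyComplex F → ∀ (p : ℕ) [Fact p.Prime] (ρ : Literature.NumberTheory.GaloisRepresentations.FramedGaloisRep F (PadicAlgCl p) 2), ρ.toGaloisRep.IsIrreducible → (∀ᶠ v : IsDedekindDomain.HeightOneSpectrum (NumberField.RingOfIntegers F) in Filter.cofinite, ρ.IsUnramifiedAt v) → (∀ (v : IsDedekindDomain.HeightOneSpectrum (NumberField.RingOfIntegers F)) (hv : ((p : ℕ) : NumberField.RingOfIntegers F) ∈ v.asIdeal), (Literature.NumberTheory.PAdicHodge.fontainePstAdicCompletion v p hv).IsDeRhamFramed (ρ.toLocal v) ∧ (letI := (Literature.NumberTheory.PAdicHodge.fontainePstAdicCompletion v p hv).algebra; ∀ τ : v.adicCompletion F →ₐ[ℚ_[p]] PadicAlgCl p, ∃ a b : ℤ, a < b ∧ ρ.labelledHodgeTateWeightsAt v (Literature.NumberTheory.PAdicHodge.fontainePstAdicCompletion v p hv).algebra (Literature.NumberTheory.PAdicHodge.fontainePstAdicCompletion v p hv).𝔅 τ.toRingHom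 = {a, b})) → ¬ (∀ v : IsDedekindDomain.HeightOneSpectrum (NumberField.RingOfIntegers F), ((p : ℕ) : NumberField.RingOfIntegers F) ∈ v.asIdeal → Literature.NumberTheory.GaloisRepresentations.FramedRep.HasInvariantCompleteFlag (ρ.toLocal v)) → 11 ≤ p → ¬ (∃ v w : IsDedekindDomain.HeightOneSpectrum (NumberField.RingOfIntegers F), v ≠ w ∧ ((p : ℕ) : NumberField.RingOfIntegers F) ∈ v.asIdeal ∧ ((p : ℕ) : NumberField.RingOfIntegers F) ∈ w.asIdeal) → Literature.NumberTheory.GaloisRepresentations.FramedGaloisRep.IsResiduallyAbsIrreducible (ρ.restrictField (CyclotomicField p F)) → ∃ g : ℤ, ∀ (v : IsDedekindDomain.HeightOneSpectrum (NumberField.RingOfIntegers F)) (hv : ((p : ℕ) : NumberField.RingOfIntegers F) ∈ v.asIdeal), letI := (Literature.NumberTheory.PAdicHodge.fontainePstAdicCompletion v p hv).algebra; ∀ τ : v.adicCompletion F →ₐ[ℚ_[p]] PadicAlgCl p, ∃ a : ℤ, ρ.labelledHodgeTateWeightsAt v (Literature.NumberTheory.PAdicHodge.fontainePstAdicCompletion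 v p hv).algebra (Literature.NumberTheory.PAdicHodge.fontainePstAdicCompletion v p hv).𝔅 τ.toRingHom = {a, a + g}) →
    (∀ (F : Type) [Field F] [NumberField F] [Algebra.IsQuadraticExtension ℚ F], NumberField.IsTotallyComplex F → ∀ (p : ℕ) [Fact p.Prime] (ρ : Literature.NumberTheory.GaloisRepresentations.FramedGaloisRep F (PadicAlgCl p) 2), ρ.toGaloisRep.IsIrreducible → (∀ᶠ v : IsDedekindDomain.HeightOneSpectrum (NumberField.RingOfIntegers F) in Filter.cofinite, ρ.IsUnramifiedAt v) → (∀ (v : IsDedekindDomain.HeightOneSpectrum (NumberField.RingOfIntegers F)) (hv : ((p : ℕ) : NumberField.RingOfIntegers F) ∈ v.asIdeal), (Literature.NumberTheory.PAdicHodge.fontainePstAdicCompletion v p hv).IsDeRhamFramed (ρ.toLocal v) ∧ (letI := (Literature.NumberTheory.PAdicHodge.fontainePstAdicCompletion v p hv).algebra; ∀ τ : v.adicCompletion F →ₐ[ℚ_[p]] PadicAlgCl p, ∃ a b : ℤ, a < b ∧ ρ.labelledHodgeTateWeightsAt v (Literature.NumberTheory.PAdicHodge.fontainePstAdicCompletion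 v p hv).algebra (Literature.NumberTheory.PAdicHodge.fontainePstAdicCompletion v p hv).𝔅 τ.toRingHom = {a, b})) → ¬ (∀ v : IsDedekindDomain.HeightOneSpectrum (NumberField.RingOfIntegers F), ((p : ℕ) : NumberField.RingOfIntegers F) ∈ v.asIdeal → Literature.NumberTheory.GaloisRepresentations.FramedRep.HasInvariantCompleteFlag (ρ.toLocal v)) → 11 ≤ p → (∃ v w : IsDedekindDomain.HeightOneSpectrum (NumberField.RingOfIntegers F), v ≠ w ∧ ((p : ℕ) : NumberField.RingOfIntegers F) ∈ v.asIdeal ∧ ((p : ℕ) : NumberField.RingOfIntegers F) ∈ w.asIdeal) → ¬ (∀ (v : IsDedekindDomain.HeightOneSpectrum (NumberField.RingOfIntegers F)) (hv : ((p : ℕ) : NumberField.RingOfIntegers F) ∈ v.asIdeal), (Literature.NumberTheory.PAdicHodge.fontainePstAdicCompletion v p hv).IsCrystallineFramed (ρ.toLocal v)) → Literature.NumberTheory.GaloisRepresentations.FramedGaloisRep.IsResiduallyAbsIrreducible (ρ.restrictField (CyclotomicField p F)) → ∃ g : ℤ, ∀ (v : IsDedekindDomain.HeightOneSpectrum (NumberField.RingOfIntegers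 F)) (hv : ((p : ℕ) : NumberField.RingOfIntegers F) ∈ v.asIdeal), letI := (Literature.NumberTheory.PAdicHodge.fontainePstAdicCompletion v p hv).algebra; ∀ τ : v.adicCompletion F →ₐ[ℚ_[p]] PadicAlgCl p, ∃ a : ℤ, ρ.labelledHodgeTateWeightsAt v (Literature.NumberTheory.PAdicHodge.fontainePstAdicCompletion v p hv).algebra (Literature.NumberTheory.PAdicHodge.fontainePstAdicCompletion v p hv).𝔅 τ.toRingHom = {a, a + g}) →
    Summit.Langlands.Langlands.Theses.NonParallelVoid.ResidueParallel := by
  intro h1 h2 h3 h4 F _ _ _ hF p _ ρ hirr hunr hHT hLR hG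
  by_cases hres : Literature.NumberTheory.GaloisRepresentations.FramedGaloisRep.IsResiduallyAbsIrreducible (ρ.restrictField (CyclotomicField p F))
  · by_cases hp : 11 ≤ p
    · by_cases hsplit : (∃ v w : IsDedekindDomain.HeightOneSpectrum (NumberField.RingOfIntegers F), v ≠ w ∧ ((p : ℕ) : NumberField.RingOfIntegers F) ∈ v.asIdeal ∧ ((p : ℕ) : NumberField.RingOfIntegers F) ∈ w.asIdeal)
      · by_cases hcrys : (∀ (v : IsDedekindDomain.HeightOneSpectrum (NumberField.RingOfIntegers F)) (hv : ((p : ℕ) : NumberField.RingOfIntegers F) ∈ v.asIdeal), (Literature.NumberTheory.PAdicHodge.fontainePstAdicCompletion v p hv).IsCrystallineFramed (ρ.toLocal v))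
        · exact absurd ⟨hp, hsplit, hcrys, hres⟩ hG
        · exact h4 F hF p ρ hirr hunr hHT hLR hp hsplit hcrys hres
      · exact h3 F hF p ρ hirr hunr hHT hLR hp hsplit hres
    · exact h2 F hF p ρ hirr hunr hHT hLR (Nat.lt_of_not_le hp) hres
  · exact h1 F hF p ρ hirr hunr hHT hLR hres

/-- Sanity (read-back): the route decl unfolds to the verbatim crux text used to cut the stubs. [bookkeeping] -/
example : Summit.Langlands.Langlands.Theses.NonParallelVoid.ResidueParallel ↔
    (∀ (F : Type) [Field F] [NumberField F] [Algebra.IsQuadraticExtension ℚ F], NumberField.IsTotallyComplex F → ∀ (p : ℕ) [Fact p.Prime] (ρ : Literature.NumberTheory.GaloisRepresentations.FramedGaloisRep F (PadicAlgCl p) 2), ρ.toGaloisRep.IsIrreducible → (∀ᶠ v : IsDedekindDomain.HeightOneSpectrum (NumberField.RingOfIntegers F) in Filter.cofinite, ρ.IsUnramifiedAt v) → (∀ (v : IsDedekindDomain.HeightOneSpectrum (NumberField.RingOfIntegers F)) (hv : ((p : ℕ) : NumberField.RingOfIntegers F) ∈ v.asIdeal), (Literature.NumberTheory.PAdicHodge.fontainePstAdicCompletion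 v p hv).IsDeRhamFramed (ρ.toLocal v) ∧ (letI := (Literature.NumberTheory.PAdicHodge.fontainePstAdicCompletion v p hv).algebra; ∀ τ : v.adicCompletion F →ₐ[ℚ_[p]] PadicAlgCl p, ∃ a b : ℤ, a < b ∧ ρ.labelledHodgeTateWeightsAt v (Literature.NumberTheory.PAdicHodge.fontainePstAdicCompletion v p hv).algebra (Literature.NumberTheory.PAdicHodge.fontainePstAdicCompletion v p hv).𝔅 τ.toRingHom = {a, b})) → ¬ (∀ v : IsDedekindDomain.HeightOneSpectrum (NumberField.RingOfIntegers F), ((p : ℕ) : NumberField.RingOfIntegers F) ∈ v.asIdeal → Literature.NumberTheory.GaloisRepresentations.FramedRep.HasInvariantCompleteFlag (ρ.toLocal v)) → ¬ (11 ≤ p ∧ (∃ v w : IsDedekindDomain.HeightOneSpectrum (NumberField.RingOfIntegers F), v ≠ w ∧ ((p : ℕ) : NumberField.RingOfIntegers F) ∈ v.asIdeal ∧ ((p : ℕ) : NumberField.RingOfIntegers F) ∈ w.asIdeal) ∧ (∀ (v : IsDedekindDomain.HeightOneSpectrum (NumberField.RingOfIntegers F)) (hv : ((p : ℕ) : NumberField.RingOfIntegers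 F) ∈ v.asIdeal), (Literature.NumberTheory.PAdicHodge.fontainePstAdicCompletion v p hv).IsCrystallineFramed (ρ.toLocal v)) ∧ Literature.NumberTheory.GaloisRepresentations.FramedGaloisRep.IsResiduallyAbsIrreducible (ρ.restrictField (CyclotomicField p F))) → ∃ g : ℤ, ∀ (v : IsDedekindDomain.HeightOneSpectrum (NumberField.RingOfIntegers F)) (hv : ((p : ℕ) : NumberField.RingOfIntegers F) ∈ v.asIdeal), letI := (Literature.NumberTheory.PAdicHodge.fontainePstAdicCompletion v p hv).algebra; ∀ τ : v.adicCompletion F →ₐ[ℚ_[p]] PadicAlgCl p, ∃ a : ℤ, ρ.labelledHodgeTateWeightsAt v (Literature.NumberTheory.PAdicHodge.fontainePstAdicCompletion v p hv).algebra (Literature.NumberTheory.PAdicHodge.fontainePstAdicCompletion v p hv).𝔅 τ.toRingHom = {a, a + g}) :=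
  Iff.rfl

end Summit.Langlands.Langlands.Cruxes.ResidueParallel.Birth

end
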